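import Summits.Ventures.PercRepro.S2BasesLower
import Summits.Ventures.PercRepro.S2CoreTwentySix
import Mathlib.Combinatorics.Enumerative.DoubleCounting

/-!
# PercRepro — S2: THE RANK-`3` SUBSETS OF A SET, COUNTED THROUGH THEIR TRIPLES (p7, gen 11; sub-claim S2; the flat count's `N₃` refinement)

On a loopless matroid whose planes have `≤ 6` points, the rank-`3` subsets of a set `W` with `j ≥ 4` points number at most
`C(|W|, 3) · C(3, j − 3) / (j − 2)`: such a set `X` lies in the plane `cl(X)` (`≤ 6` points), every rank-`3` triple `T ⊆ X` spans that plane, so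
`X ∖ T` is a `(j − 3)`-subset of `cl(T) ∖ T` (`≤ 3` points) — the pairs `(T, X)` number `≤ C(|W|, 3)·C(3, j − 3)` — and every `X` contains
`≥ j − 2` rank-`3` triples (the bases of the loopless rank-`3` restriction `M ↾ X`, S2BasesLower): **`ncard_rank_three_subsets_mul_le`**
(stated multiplied out, `N₃(j)·(j − 2) ≤ C(|W|, 3)·C(3, j − 3)`). This is the ESSENTIAL refinement of the flat count at `(15, 8)` / `(15, 9)`
(proofs/P7-S2-FLATCOUNT-G11.md §2, (L6); with the trivial `N₃(j) ≤ C(|W|, j)` the cell `(15, 8)` reads `1.017`). Axioms: standard.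
-/

open scoped Matroid

namespace PercRepro

namespace S2

variable {α : Type}

/-- **A rank-`3` set contains `≥ |X| − 2` rank-`3` triples** (the bases of the loopless restriction `M ↾ X`). -/
theorem ncard_rank_three_triples_ge (M : Matroid α) [M.Finite] (hL : ∀ e ∈ M.E, ¬ M.IsLoop e)
    {X : Set α} (hX : X ⊆ M.E) (hX3 : M.eRk X = 3) :
    X.ncard + 1 ≤ {T : Set α | T ⊆ X ∧ T.ncard = 3 ∧ M.eRk T = 3}.ncard + 3 := by
  classical
  have hXfin : X.Finite := M.ground_finite.subset hX
  haveI : (M ↾ X).Finite := M.restrict_finite hXfin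
  obtain ⟨B₀, hB₀⟩ := (M ↾ X).exists_isBase
  have hB₀' : M.IsBasis B₀ X := (Matroid.isBase_restrict_iff hX).1 hB₀
  have hB₀fin : B₀.Finite := hXfin.subset hB₀'.subset
  have hB₀card : B₀.ncard = 3 := by
    have h := hB₀'.encard_eq_eRk
    rw [hX3, ← hB₀fin.cast_ncard_eq] at h
    exact_mod_cast h
  have hL' : ∀ e ∈ (M ↾ X).E, ¬ (M ↾ X).IsLoop e := by
    intro e _ hl
    rw [Matroid.restrict_isLoop_iff] at hl
    rcases hl.2 with h | h
    · exact hL e (hX hl.1) h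
    · exact h (hX hl.1)
  have key := ncard_add_one_le_ncard_isBase_add (M ↾ X) hL' hB₀
  rw [Matroid.restrict_ground_eq, hB₀card] at key
  have hsub : {B : Set α | (M ↾ X).IsBase B} ⊆ {T : Set α | T ⊆ X ∧ T.ncard = 3 ∧ M.eRk T = 3} := by
    intro B hB
    have hB' : M.IsBasis B X := (Matroid.isBase_restrict_iff hX).1 hB
    have hBfin : B.Finite := hXfin.subset hB'.subset
    have h3 : B.encard = 3 := by rw [hB'.encard_eq_eRk, hX3]
    refine ⟨hB'.subset, ?_, ?_⟩
    · rw [← hBfin.cast_ncard_eq] at h3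
      exact_mod_cast h3
    · rw [hB'.indep.eRk_eq_encard, h3]
  have hfinT : {T : Set α | T ⊆ X ∧ T.ncard = 3 ∧ M.eRk T = 3}.Finite :=
    hXfin.finite_subsets.subset (fun T hT => hT.1)
  have := Set.ncard_le_ncard hsub hfinT
  omega

/-- The `s`-subsets of a finite set `Z` number `C(|Z|, s)` (the tree's `ncard_subsets_ncard_mem` at a singleton). -/
theorem ncard_subsets_ncard_eq (Z : Set α) (hZ : Z.Finite) (s : ℕ) :
    {Y : Set α | Y ⊆ Z ∧ Y.ncard = s}.ncard = Z.ncard.choose s := by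
  have h := ThmN.ncard_subsets_ncard_mem hZ.toFinset {s}
  simp only [Finset.sum_singleton, Set.Finite.coe_toFinset, Finset.mem_singleton] at h
  rw [h, Set.ncard_eq_toFinset_card Z hZ]

/-- **`N₃(j)`**: on a loopless matroid with planes of `≤ 6` points, the rank-`3` `j`-subsets of `W ⊆ E` (`j ≥ 4`) satisfy
`N₃(j) · (j − 2) ≤ C(|W|, 3) · C(3, j − 3)`. -/
theorem ncard_rank_three_subsets_mul_le (M : Matroid α) [M.Finite] (hL : ∀ e ∈ M.E, ¬ M.IsLoop e)
    (hplane : ∀ P ⊆ M.E, M.eRk P ≤ 3 → P.ncard ≤ 6) {W : Set α} (hW : W ⊆ M.E) (j : ℕ) (hj : 4 ≤ j) :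
    {X : Set α | X ⊆ W ∧ X.ncard = j ∧ M.eRk X = 3}.ncard * (j - 2) ≤ W.ncard.choose 3 * Nat.choose 3 (j - 3) := by
  classical
  have hWfin : W.Finite := M.ground_finite.subset hW
  have h𝒳fin : {X : Set α | X ⊆ W ∧ X.ncard = j ∧ M.eRk X = 3}.Finite :=
    hWfin.finite_subsets.subset (fun X hX => hX.1)
  have h𝒯fin : {T : Set α | T ⊆ W ∧ T.ncard = 3}.Finite :=
    hWfin.finite_subsets.subset (fun T hT => hT.1)
  have h𝒯card : {T : Set α | T ⊆ W ∧ T.ncard = 3}.ncard = W.ncard.choose 3 := ncard_subsets_ncard_eq W hWfin 3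
  -- the double count on the finsets
  set s : Finset (Set α) := h𝒳fin.toFinset with hs
  set t : Finset (Set α) := h𝒯fin.toFinset with ht
  let r : Set α → Set α → Prop := fun X T => T ⊆ X ∧ M.eRk T = 3
  have hm : ∀ X ∈ s, j - 2 ≤ (t.bipartiteAbove r X).card := by
    intro X hXs
    rw [hs, Set.Finite.mem_toFinset] at hXs
    obtain ⟨hXW, hXj, hX3⟩ := hXs
    have h1 := ncard_rank_three_triples_ge M hL (hXW.trans hW) hX3
    rw [hXj] at h1
    have hsub : {T : Set α | T ⊆ X ∧ T.ncard = 3 ∧ M.eRk T = 3} ⊆ (t.bipartiteAbove r X : Set (Set α)) := by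
      intro T hT
      rw [Finset.coe_bipartiteAbove]
      refine ⟨?_, hT.1, hT.2.2⟩
      rw [ht, Set.Finite.mem_toFinset]
      exact ⟨hT.1.trans hXW, hT.2.1⟩
    have h2 := Set.ncard_le_ncard hsub (Finset.finite_toSet _)
    rw [Set.ncard_coe_finset] at h2
    omega
  have hn : ∀ T ∈ t, (s.bipartiteBelow r T).card ≤ Nat.choose 3 (j - 3) := by
    intro T hTt
    rw [ht, Set.Finite.mem_toFinset] at hTt
    obtain ⟨hTW, hT3⟩ := hTt
    have hTE : T ⊆ M.E := hTW.trans hW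
    have hTfin : T.Finite := hWfin.subset hTW
    -- the sets X of the fibre lie in the plane `cl(T)` when `ρ(T) = 3`; map `X ↦ X ∖ T`
    by_cases hT3r : M.eRk T = 3
    · have hclE : M.closure T ⊆ M.E := M.closure_subset_ground T
      have hcl3 : M.eRk (M.closure T) ≤ 3 := by rw [M.eRk_closure_eq, hT3r]
      have hclcard : (M.closure T).ncard ≤ 6 := hplane _ hclE hcl3
      have hclfin : (M.closure T).Finite := M.ground_finite.subset hclE
      have hTcl : T ⊆ M.closure T := M.subset_closure T hTE
      have hZcard : (M.closure T \ T).ncard ≤ 3 := by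
        rw [Set.ncard_sdiff hTcl hTfin, hT3]
        omega
      have hfib : ((s.bipartiteBelow r T : Finset (Set α)) : Set (Set α)).ncard ≤
          {Y : Set α | Y ⊆ M.closure T \ T ∧ Y.ncard = j - 3}.ncard := by
        refine Set.ncard_le_ncard_of_injOn (fun X => X \ T) ?_ ?_
          (hclfin.finite_subsets.subset (fun Y hY => hY.1.trans Set.sdiff_subset))
        · intro X hX
          rw [Finset.mem_coe, Finset.mem_bipartiteBelow] at hX
          obtain ⟨hXs, hTX, -⟩ := hX
          rw [hs, Set.Finite.mem_toFinset] at hXs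
          obtain ⟨hXW, hXj, hX3⟩ := hXs
          have hXfin : X.Finite := hWfin.subset hXW
          -- X ⊆ cl(T): cl(T) = cl(X) since T ⊆ X and ρ(X) ≤ ρ(T)
          have hrk : M.IsRkFinite T := M.isRkFinite_of_finite hTfin
          have hcl : M.closure T = M.closure X :=
            hrk.closure_eq_closure_of_subset_of_eRk_ge_eRk hTX (by rw [hX3, hT3r])
          have hXcl : X ⊆ M.closure T := by
            rw [hcl]
            exact M.subset_closure X (hXW.trans hW)
          refine ⟨Set.sdiff_subset_sdiff_left hXcl, ?_⟩
          rw [Set.ncard_sdiff hTX hTfin, hXj, hT3]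
        · intro X hX Y hY hXY
          rw [Finset.mem_coe, Finset.mem_bipartiteBelow] at hX hY
          have hTX : T ⊆ X := hX.2.1
          have hTY : T ⊆ Y := hY.2.1
          simp only at hXY
          rw [← Set.sdiff_union_of_subset hTX, ← Set.sdiff_union_of_subset hTY, hXY]
      rw [Set.ncard_coe_finset, ncard_subsets_ncard_eq _ (hclfin.subset Set.sdiff_subset)] at hfib
      exact hfib.trans (Nat.choose_le_choose _ hZcard)
    · -- no X of the fibre: the relation needs `ρ(T) = 3`
      have hempty : s.bipartiteBelow r T = ∅ := by
        rw [Finset.eq_empty_iff_forall_notMem]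
        intro X hX
        rw [Finset.mem_bipartiteBelow] at hX
        exact hT3r hX.2.2
      rw [hempty, Finset.card_empty]
      exact Nat.zero_le _
  have hdc := Finset.card_mul_le_card_mul r hm hn
  have hs_card : s.card = {X : Set α | X ⊆ W ∧ X.ncard = j ∧ M.eRk X = 3}.ncard := by
    rw [hs, Set.ncard_eq_toFinset_card _ h𝒳fin]
  have ht_card : t.card = {T : Set α | T ⊆ W ∧ T.ncard = 3}.ncard := by
    rw [ht, Set.ncard_eq_toFinset_card _ h𝒯fin]
  rw [hs_card, ht_card, h𝒯card] at hdc
  exact hdc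

end S2

end PercRepro
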